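import Mathlib
import Literature.MathematicalPhysics.QuantumLattice.WilsonDiracAP
import Literature.MathematicalPhysics.QuantumFieldTheory.ConstructiveQFTWave0Proofs
import Summits.QuantumFields.QCD.Theorems.QuarksAsStableActionDefs
import HarnessLib

/-!
# Temporal gauge on the two crossing layers (stub `stub_temporalGauge` of crux
stmt-QuantumFields-9735, line Sketch)

For the bond-diluted signed Wilson-quark partition function
`Zb(E) = ∫ ∏_f det D_E[U, m_f] e^{-β S_W(U)} ∏ dU` on the four-torus of side `L ≥ 4` we prove
that the temporal links crossing the two link-reflection hyperplanes (`WilsonRP.crossEdges`: the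
layers `t = 0 → 1` and `t = L/2 → L/2 + 1`) may be replaced by `1` inside the integrand:
`∫ G(U) dπ = ∫ G(splice crossEdges (U, 1)) dπ`.

* `bondWilsonDirac_gaugeTransform`, `det_bondWilsonDiracAP_gaugeTransform` — gauge covariance
  of the diluted Wilson–Dirac operator `D_E[U^g] = 𝒢(g) D_E[U] 𝒢(g)⁻¹` (bond by bond, as the
  tree's `wilsonDirac_gaugeTransform`) and gauge invariance of the diluted antiperiodic
  determinant.
* The temporal gauge transformation `Ω_U`: at the head `z` of a crossing link (slices `1` and
  `L/2 + 1`) the value `U(z - ê₀, 0)` of that link, `1` elsewhere; the skew translation `Ψ(U)`: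
  crossing links unchanged, every other link gauge transformed by `Ω_U`.  Pointwise
  (`splice_eq_gaugeTransform`, `not_isCrossEdge_sub_single`, `4 ≤ L`):
  `splice crossEdges (Ψ U, 1) = U^{Ω_U}` (two separated layers of links carry no closed loop).
* `exists_gaugeAway` — `Ψ` is a measurable equivalence preserving the product Haar measure: a
  skew product over the crossing coordinates of two-sided Haar translations of the remaining
  coordinates (`MeasurePreserving.skew_product`, `measurePreserving_piEquivPiSubtypeProd`,
  `WilsonGauge.measurePreserving_mul_mul`).
* `integral_eq_integral_splice_crossEdges` — for every gauge-invariant `F`,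
  `∫ F dπ = ∫ F (splice crossEdges (·, 1)) dπ` (`MeasurePreserving.integral_comp'`);
  `stub_temporalGauge` is the case of the diluted signed Boltzmann weight
  (`wilsonAction_gaugeTransform`).
-/

noncomputable section

open MeasureTheory Matrix Complex Finset
open Literature.MathematicalPhysics.QuantumFieldTheory Literature.MathematicalPhysics.QuantumLattice
open Summit.QuantumFields.QCD.Theorems.QuarksAsStableAction
open scoped ComplexConjugate BigOperators ComplexOrder

namespace Summit.QuantumFields.QCD.Theorems.UnquenchedChessboardBoundLine

namespace TemporalGauge

/-! ## Gauge covariance of the diluted Wilson–Dirac operator -/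

section Covariance

variable {L N : ℕ} [NeZero L] {G : Type*} [Group G] (ρ : G →* Matrix (Fin N) (Fin N) ℂ)

/-- The diluted operator as mass term minus half the sum of the bond-masked hopping matrices:
`D_E = (m + 4r)·1 - ½ Σ_μ (χ_μ H⁺_μ + H⁻_μ χ_μ)` with the diagonal bond mask
`χ_μ = diag [(x, μ) ∈ E]` (the forward hop of row `x` and the backward hop of column `x` in
direction `μ` are kept iff `(x, μ) ∈ E`). -/
theorem bondWilsonDirac_eq (E : Finset (Edge 4 L)) (U : GaugeConfig 4 L G) (m r : ℝ) :
    bondWilsonDirac ρ E U m r =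
      ((m + 4 * r : ℝ) : ℂ) •
          (1 : Matrix (Site 4 L × Fin N × Fin 4) (Site 4 L × Fin N × Fin 4) ℂ) -
        (1 / 2 : ℂ) • ∑ μ : Fin 4,
          (Matrix.diagonal (fun p : Site 4 L × Fin N × Fin 4 =>
              if (p.1, μ) ∈ E then (1 : ℂ) else 0) * wilsonHopFwd ρ U r μ +
            wilsonHopBwd ρ U r μ * Matrix.diagonal (fun p : Site 4 L × Fin N × Fin 4 =>
              if (p.1, μ) ∈ E then (1 : ℂ) else 0)) := by
  ext p q
  simp only [bondWilsonDirac, wilsonHopFwd, wilsonHopBwd, Matrix.of_apply, Matrix.sub_apply,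
    Matrix.smul_apply, Matrix.one_apply, smul_eq_mul, mul_ite, mul_one, mul_zero, Matrix.sum_apply,
    Matrix.add_apply, Matrix.diagonal_mul, Matrix.mul_diagonal, ite_mul, one_mul, zero_mul]
  congr 1
  refine congrArg _ (Finset.sum_congr rfl fun μ _ => ?_)
  congr 1
  · by_cases h1 : (p.1, μ) ∈ E <;> by_cases h2 : q.1 = Site.shift p.1 μ <;> simp [h1, h2]
  · by_cases h1 : (q.1, μ) ∈ E <;> by_cases h2 : p.1 = Site.shift q.1 μ <;> simp [h1, h2]

/-- A site-dependent scalar diagonal matrix commutes with gauge rotations. -/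
theorem gaugeRotation_mul_diagonal (g : Site 4 L → G) (d : Site 4 L × Fin N × Fin 4 → ℂ)
    (hd : ∀ p q, p.1 = q.1 → d p = d q) :
    gaugeRotation ρ (Fin 4) g * Matrix.diagonal d = Matrix.diagonal d * gaugeRotation ρ (Fin 4) g := by
  ext p q
  simp only [Matrix.mul_diagonal, Matrix.diagonal_mul, gaugeRotation, Matrix.of_apply]
  by_cases h : p.1 = q.1
  · rw [hd p q h, mul_comm]
  · rw [if_neg h, zero_mul, mul_zero]

/-- **Gauge covariance of the diluted Wilson–Dirac operator**: `D_E[U^g] = 𝒢(g) D_E[U] 𝒢(g)⁻¹`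
(bond by bond, as the tree's `wilsonDirac_gaugeTransform`; Montvay–Münster §5.1.1 (5.3)–(5.5)). -/
theorem bondWilsonDirac_gaugeTransform (E : Finset (Edge 4 L)) (g : Site 4 L → G)
    (U : GaugeConfig 4 L G) (m r : ℝ) :
    bondWilsonDirac ρ E (gaugeTransform g U) m r =
      gaugeRotation ρ (Fin 4) g * bondWilsonDirac ρ E U m r * gaugeRotation ρ (Fin 4) g⁻¹ := by
  have hd : ∀ (μ : Fin 4) (p q : Site 4 L × Fin N × Fin 4), p.1 = q.1 →
      (if (p.1, μ) ∈ E then (1 : ℂ) else 0) = (if (q.1, μ) ∈ E then (1 : ℂ) else 0) :=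
    fun μ p q h => by rw [h]
  have hf : ∀ (μ : Fin 4) (X : Matrix _ _ ℂ),
      Matrix.diagonal (fun p : Site 4 L × Fin N × Fin 4 => if (p.1, μ) ∈ E then (1 : ℂ) else 0) *
          (gaugeRotation ρ (Fin 4) g * X * gaugeRotation ρ (Fin 4) g⁻¹) =
        gaugeRotation ρ (Fin 4) g * (Matrix.diagonal (fun p : Site 4 L × Fin N × Fin 4 =>
          if (p.1, μ) ∈ E then (1 : ℂ) else 0) * X) * gaugeRotation ρ (Fin 4) g⁻¹ := fun μ X => by
    rw [← Matrix.mul_assoc, ← Matrix.mul_assoc, ← gaugeRotation_mul_diagonal ρ g _ (hd μ)]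
    simp only [Matrix.mul_assoc]
  have hb : ∀ (μ : Fin 4) (X : Matrix _ _ ℂ),
      gaugeRotation ρ (Fin 4) g * X * gaugeRotation ρ (Fin 4) g⁻¹ *
          Matrix.diagonal (fun p : Site 4 L × Fin N × Fin 4 => if (p.1, μ) ∈ E then (1 : ℂ) else 0) =
        gaugeRotation ρ (Fin 4) g * (X * Matrix.diagonal (fun p : Site 4 L × Fin N × Fin 4 =>
          if (p.1, μ) ∈ E then (1 : ℂ) else 0)) * gaugeRotation ρ (Fin 4) g⁻¹ := fun μ X => by
    rw [Matrix.mul_assoc, gaugeRotation_mul_diagonal ρ g⁻¹ _ (hd μ)]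
    simp only [Matrix.mul_assoc]
  rw [bondWilsonDirac_eq, bondWilsonDirac_eq]
  simp only [Matrix.mul_sub, Matrix.sub_mul, Matrix.mul_smul, Matrix.smul_mul, Matrix.mul_one,
    gaugeRotation_mul_inv, Matrix.mul_sum, Matrix.sum_mul, Matrix.mul_add, Matrix.add_mul,
    wilsonHopFwd_gaugeTransform, wilsonHopBwd_gaugeTransform, hf, hb]

/-- **Gauge invariance of the diluted Wilson fermion determinant**: `det D_E[U^g] = det D_E[U]`. -/
theorem det_bondWilsonDirac_gaugeTransform (E : Finset (Edge 4 L)) (g : Site 4 L → G)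
    (U : GaugeConfig 4 L G) (m r : ℝ) :
    (bondWilsonDirac ρ E (gaugeTransform g U) m r).det = (bondWilsonDirac ρ E U m r).det := by
  rw [bondWilsonDirac_gaugeTransform, det_mul, det_mul, mul_right_comm, ← det_mul,
    gaugeRotation_mul_inv, det_one, one_mul]

/-- **Gauge invariance of the diluted antiperiodic determinant** `det D_E[apLift U^g] =
det D_E[apLift U]` (the antiperiodic lift intertwines `SU(N)` and `U(N)` gauge transformations,
`apLift_gaugeTransform`). -/
theorem det_bondWilsonDiracAP_gaugeTransform (E : Finset (Edge 4 L))
    (g : Site 4 L → Matrix.specialUnitaryGroup (Fin N) ℂ)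
    (U : GaugeConfig 4 L (Matrix.specialUnitaryGroup (Fin N) ℂ)) (m : ℝ) :
    (bondWilsonDiracAP E (gaugeTransform g U) m).det = (bondWilsonDiracAP E U m).det := by
  rw [bondWilsonDiracAP, bondWilsonDiracAP, apLift_gaugeTransform]
  exact det_bondWilsonDirac_gaugeTransform _ E _ _ m 1

end Covariance

/-! ## Geometry of the two crossing layers -/

section Geometry

variable {L : ℕ} {G : Type*} [Group G]

/-- `(z - ê₀) + ê₀ = z`. -/
theorem shift_sub_single (z : Site 4 L) : Site.shift (z - Pi.single 0 1) 0 = z :=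
  sub_add_cancel z _

/-- `(z + ê₀) - ê₀ = z`. -/
theorem shift_zero_sub_single (z : Site 4 L) : Site.shift z 0 - Pi.single 0 1 = z :=
  add_sub_cancel_right z _

variable [NeZero L] [Fact (1 < L)]

/-- For `L ≥ 4` the tail `z` of a crossing link `(z, 0)` is not the head of a crossing link:
`(z - ê₀, 0)` is not crossing (the layers `0 → 1` and `L/2 → L/2 + 1` are separated). -/
theorem not_isCrossEdge_sub_single (h4 : 4 ≤ L) {z : Site 4 L}
    (hz : WilsonRP.IsCrossEdge ((z, 0) : Edge 4 L)) :
    ¬ WilsonRP.IsCrossEdge ((z - Pi.single 0 1, 0) : Edge 4 L) := by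
  intro hb
  have hv : (z 0).val = ((Site.shift (z - Pi.single 0 1) 0) 0).val := by rw [shift_sub_single]
  rw [WilsonRP.val_shift_self] at hv
  have h1 := hz.2
  have h2 := hb.2
  simp only at h1 h2
  split_ifs at hv with h <;> omega

omit [Fact (1 < L)] in
/-- **The pointwise identity** `splice crossEdges (Ψ U, 1) = U^{g}`: if `V = Ψ U` is
`g(x) U(x,μ) g(x + ê_μ)⁻¹` off the crossing links, and the gauge function `g` is `1` at the tail
and `U(z, 0)` at the head of every crossing link `(z, 0)`, then splicing `1` into the crossing
links of `V` gives the gauge transform of `U` by `g` (on a crossing link: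
`g(z) U(z,0) g(z + ê₀)⁻¹ = U(z,0) U(z,0)⁻¹ = 1`). -/
theorem splice_eq_gaugeTransform (U V : GaugeConfig 4 L G) (g : Site 4 L → G)
    (hV : ∀ e, ¬ WilsonRP.IsCrossEdge e → V e = g e.1 * U e * (g (Site.shift e.1 e.2))⁻¹)
    (hg1 : ∀ z, WilsonRP.IsCrossEdge ((z, 0) : Edge 4 L) → g z = 1)
    (hg2 : ∀ z, WilsonRP.IsCrossEdge ((z, 0) : Edge 4 L) → g (Site.shift z 0) = U (z, 0)) :
    LatticeRP.splice WilsonRP.crossEdges (V, 1) = gaugeTransform g U := by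
  funext e
  rw [LatticeRP.splice_apply]
  by_cases he : WilsonRP.IsCrossEdge e
  · rw [if_pos (WilsonRP.mem_crossEdges.2 he)]
    dsimp only
    rw [Pi.one_apply, gaugeTransform]
    obtain ⟨z, μ⟩ := e
    have hμ : μ = 0 := he.1
    subst hμ
    dsimp only
    rw [hg1 z he, hg2 z he, one_mul, mul_inv_cancel]
  · rw [if_neg (fun h => he (WilsonRP.mem_crossEdges.1 h))]
    dsimp only
    rw [hV e he, gaugeTransform]

end Geometry

/-! ## The skew translation `Ψ` preserves the product Haar measure -/

section Measure

variable {L : ℕ} [NeZero L] {G : Type*} [Group G] [MeasurableSpace G] [TopologicalSpace G]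
  [IsTopologicalGroup G] [CompactSpace G] [BorelSpace G] [SecondCountableTopology G]

/-- **The skew translation `Ψ` as a measure-preserving measurable equivalence.** `Ψ U` keeps the
crossing links of `U` and replaces every other link `U(x, μ)` by `Ω_U(x) U(x,μ) Ω_U(x + ê_μ)⁻¹`,
where `Ω_U(z) = U(z - ê₀, 0)` if `(z - ê₀, 0)` is a crossing link and `1` otherwise. Splitting
the coordinates into crossing and non-crossing ones (`measurePreserving_piEquivPiSubtypeProd`),
`Ψ` is a skew product whose fibre maps are products of two-sided Haar translations
(`WilsonGauge.measurePreserving_mul_mul`, `measurePreserving_pi`), so it preserves `∏ₑ dU_e`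
(`MeasurePreserving.skew_product`). -/
theorem exists_gaugeAway :
    ∃ Ψ : GaugeConfig 4 L G ≃ᵐ GaugeConfig 4 L G,
      MeasurePreserving Ψ (Measure.pi fun _ : Edge 4 L => haarProbability G)
          (Measure.pi fun _ : Edge 4 L => haarProbability G) ∧
        ∀ U e, Ψ U e = if WilsonRP.IsCrossEdge e then U e else
          (if WilsonRP.IsCrossEdge ((e.1 - Pi.single 0 1, 0) : Edge 4 L)
              then U (e.1 - Pi.single 0 1, 0) else 1) * U e *
            (if WilsonRP.IsCrossEdge ((Site.shift e.1 e.2 - Pi.single 0 1, 0) : Edge 4 L)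
              then U (Site.shift e.1 e.2 - Pi.single 0 1, 0) else 1)⁻¹ := by
  -- the gauge function `Ω(a)` read off from the crossing coordinates `a`
  let Ω : ({e : Edge 4 L // WilsonRP.IsCrossEdge e} → G) → Site 4 L → G := fun a z =>
    if h : WilsonRP.IsCrossEdge ((z - Pi.single 0 1, 0) : Edge 4 L)
      then a ⟨(z - Pi.single 0 1, 0), h⟩ else 1
  have hΩapply : ∀ a z, Ω a z = if h : WilsonRP.IsCrossEdge ((z - Pi.single 0 1, 0) : Edge 4 L)
      then a ⟨(z - Pi.single 0 1, 0), h⟩ else 1 := fun _ _ => rfl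
  have hΩ : ∀ z, Measurable fun a : {e : Edge 4 L // WilsonRP.IsCrossEdge e} → G => Ω a z := by
    intro z
    simp only [hΩapply]
    split_ifs
    · exact measurable_pi_apply _
    · exact measurable_const
  have hΩ1 : ∀ z, Measurable fun p : ({e : Edge 4 L // WilsonRP.IsCrossEdge e} → G) ×
      ({e : Edge 4 L // ¬ WilsonRP.IsCrossEdge e} → G) => Ω p.1 z :=
    fun z => (hΩ z).comp measurable_fst
  have hπ2 : ∀ i : {e : Edge 4 L // ¬ WilsonRP.IsCrossEdge e},
      Measurable fun p : ({e : Edge 4 L // WilsonRP.IsCrossEdge e} → G) ×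
        ({e : Edge 4 L // ¬ WilsonRP.IsCrossEdge e} → G) => p.2 i :=
    fun i => (measurable_pi_apply i).comp measurable_snd
  -- the fibre map and its inverse
  let φ : ({e : Edge 4 L // WilsonRP.IsCrossEdge e} → G) →
      ({e : Edge 4 L // ¬ WilsonRP.IsCrossEdge e} → G) →
        ({e : Edge 4 L // ¬ WilsonRP.IsCrossEdge e} → G) :=
    fun a b i => Ω a i.1.1 * b i * (Ω a (Site.shift i.1.1 i.1.2))⁻¹
  let φ' : ({e : Edge 4 L // WilsonRP.IsCrossEdge e} → G) →
      ({e : Edge 4 L // ¬ WilsonRP.IsCrossEdge e} → G) →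
        ({e : Edge 4 L // ¬ WilsonRP.IsCrossEdge e} → G) :=
    fun a b i => (Ω a i.1.1)⁻¹ * b i * Ω a (Site.shift i.1.1 i.1.2)
  have hφapply : ∀ a b i, φ a b i = Ω a i.1.1 * b i * (Ω a (Site.shift i.1.1 i.1.2))⁻¹ :=
    fun _ _ _ => rfl
  have hφ'apply : ∀ a b i, φ' a b i = (Ω a i.1.1)⁻¹ * b i * Ω a (Site.shift i.1.1 i.1.2) :=
    fun _ _ _ => rfl
  have hφ : Measurable fun p : ({e : Edge 4 L // WilsonRP.IsCrossEdge e} → G) ×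
      ({e : Edge 4 L // ¬ WilsonRP.IsCrossEdge e} → G) => φ p.1 p.2 :=
    measurable_pi_lambda _ fun i =>
      ((hΩ1 i.1.1).fun_mul (hπ2 i)).fun_mul (hΩ1 (Site.shift i.1.1 i.1.2)).fun_inv
  have hφ' : Measurable fun p : ({e : Edge 4 L // WilsonRP.IsCrossEdge e} → G) ×
      ({e : Edge 4 L // ¬ WilsonRP.IsCrossEdge e} → G) => φ' p.1 p.2 :=
    measurable_pi_lambda _ fun i =>
      ((hΩ1 i.1.1).fun_inv.fun_mul (hπ2 i)).fun_mul (hΩ1 (Site.shift i.1.1 i.1.2))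
  -- the skew product as a measurable equivalence
  let Θ : (({e : Edge 4 L // WilsonRP.IsCrossEdge e} → G) ×
      ({e : Edge 4 L // ¬ WilsonRP.IsCrossEdge e} → G)) ≃ᵐ
        (({e : Edge 4 L // WilsonRP.IsCrossEdge e} → G) ×
          ({e : Edge 4 L // ¬ WilsonRP.IsCrossEdge e} → G)) :=
    { toFun := fun p => (p.1, φ p.1 p.2)
      invFun := fun p => (p.1, φ' p.1 p.2)
      left_inv := fun p => Prod.ext rfl (funext fun i => by simp [hφapply, hφ'apply, mul_assoc])
      right_inv := fun p => Prod.ext rfl (funext fun i => by simp [hφapply, hφ'apply, mul_assoc])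
      measurable_toFun := measurable_fst.prodMk hφ
      measurable_invFun := measurable_fst.prodMk hφ' }
  have hΘapply : ∀ p, Θ p = (p.1, φ p.1 p.2) := fun _ => rfl
  have hΘ : MeasurePreserving Θ
      ((Measure.pi fun _ : {e : Edge 4 L // WilsonRP.IsCrossEdge e} => haarProbability G).prod
        (Measure.pi fun _ : {e : Edge 4 L // ¬ WilsonRP.IsCrossEdge e} => haarProbability G))
      ((Measure.pi fun _ : {e : Edge 4 L // WilsonRP.IsCrossEdge e} => haarProbability G).prod
        (Measure.pi fun _ : {e : Edge 4 L // ¬ WilsonRP.IsCrossEdge e} => haarProbability G)) := by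
    refine (MeasurePreserving.id _).skew_product (g := φ) hφ
      (Filter.Eventually.of_forall fun a => ?_)
    exact (measurePreserving_pi
      (f := fun (i : {e : Edge 4 L // ¬ WilsonRP.IsCrossEdge e}) (x : G) =>
        Ω a i.1.1 * x * (Ω a (Site.shift i.1.1 i.1.2))⁻¹)
      (fun _ => haarProbability G) (fun _ => haarProbability G)
      fun i => WilsonGauge.measurePreserving_mul_mul (Ω a i.1.1)
        (Ω a (Site.shift i.1.1 i.1.2))⁻¹).map_eq
  -- reassemble
  refine ⟨((MeasurableEquiv.piEquivPiSubtypeProd (fun _ : Edge 4 L => G) WilsonRP.IsCrossEdge).trans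
      Θ).trans (MeasurableEquiv.piEquivPiSubtypeProd (fun _ : Edge 4 L => G) WilsonRP.IsCrossEdge).symm,
    ((measurePreserving_piEquivPiSubtypeProd (fun _ : Edge 4 L => haarProbability G)
      WilsonRP.IsCrossEdge).symm _).comp (hΘ.comp (measurePreserving_piEquivPiSubtypeProd
        (fun _ : Edge 4 L => haarProbability G) WilsonRP.IsCrossEdge)), fun U x => ?_⟩
  have hΩU : ∀ z, Ω (fun c : {e : Edge 4 L // WilsonRP.IsCrossEdge e} => U c) z =
      if WilsonRP.IsCrossEdge ((z - Pi.single 0 1, 0) : Edge 4 L) then U (z - Pi.single 0 1, 0)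
      else 1 := fun z => by
    simp only [hΩapply]
    split_ifs <;> rfl
  simp only [MeasurableEquiv.coe_trans, Function.comp_apply, hΘapply,
    MeasurableEquiv.piEquivPiSubtypeProd_symm_apply, MeasurableEquiv.piEquivPiSubtypeProd_apply]
  by_cases hx : WilsonRP.IsCrossEdge x
  · rw [dif_pos hx, if_pos hx]
  · rw [dif_neg hx, if_neg hx]
    simp only [hφapply, hΩU]

variable [Fact (1 < L)]

/-- **Temporal gauge on the two crossing layers, abstract form**: for every gauge-invariant
`F : G^{links} → ℂ` and `L ≥ 4`, `∫ F dπ = ∫ F(splice crossEdges (U, 1)) dπ(U)`: change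
variables by the measure-preserving equivalence `Ψ` and use `F(splice C (Ψ U, 1)) = F(U^{Ω_U}) =
F(U)`. -/
theorem integral_eq_integral_splice_crossEdges (h4 : 4 ≤ L) {F : GaugeConfig 4 L G → ℂ}
    (hF : IsGaugeInvariant F) :
    ∫ U, F U ∂(Measure.pi fun _ : Edge 4 L => haarProbability G) =
      ∫ U, F (LatticeRP.splice WilsonRP.crossEdges (U, 1))
        ∂(Measure.pi fun _ : Edge 4 L => haarProbability G) := by
  obtain ⟨Ψ, hΨ, hΨU⟩ := exists_gaugeAway (L := L) (G := G)
  rw [← hΨ.integral_comp' (fun U => F (LatticeRP.splice WilsonRP.crossEdges (U, 1)))]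
  refine integral_congr_ae (Filter.Eventually.of_forall fun U => ?_)
  simp only
  rw [splice_eq_gaugeTransform U (Ψ U)
    (fun z => if WilsonRP.IsCrossEdge ((z - Pi.single 0 1, 0) : Edge 4 L)
      then U (z - Pi.single 0 1, 0) else 1)
    (fun e he => by rw [hΨU, if_neg he])
    (fun z hz => by rw [if_neg (not_isCrossEdge_sub_single h4 hz)])
    (fun z hz => by rw [shift_zero_sub_single, if_pos hz]), hF]

end Measure

end TemporalGauge

open TemporalGauge in
/-- **Stub `temporalGauge`** (temporal gauge on the two crossing layers): the diluted signed
partition function is unchanged if, inside the integrand, the temporal links crossing the two link-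
reflection hyperplanes (`WilsonRP.crossEdges`: `t = 0 → 1` and `t = L/2 → L/2 + 1`) are replaced by
`1` (`LatticeRP.splice WilsonRP.crossEdges (U, 1)`): gauge invariance of `det D_E` and of `S_W` under
the gauge transformation `Ω_U` that is the crossing link at the sites of the slices `1` and `L/2 + 1`
and `1` elsewhere (pointwise `G(U) = G(U^{Ω_U})`, two disjoint layers of links carry no closed
loop), then Haar invariance of the remaining link variables under the `U_cross`-dependent
translations and Fubini. (`4 ≤ L`: for `L = 2` the two layers would close into Polyakov loops and
the statement fails — w-gauge's remark.) -/
theorem stub_temporalGauge (Nf L : ℕ) [NeZero L] [Fact (1 < L)] (h4 : 4 ≤ L) (β : ℝ)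
    (m : Fin Nf → ℝ) (E : Finset (Edge 4 L)) :
    ∫ U, (∏ f, (bondWilsonDiracAP E U (m f)).det) *
            (Real.exp (-β * wilsonAction (fundamentalRep (Fin 3)) U) : ℂ)
          ∂(Measure.pi fun _ : Edge 4 L => haarProbability (Matrix.specialUnitaryGroup (Fin 3) ℂ)) =
      ∫ U, (∏ f, (bondWilsonDiracAP E (LatticeRP.splice WilsonRP.crossEdges (U, 1)) (m f)).det) *
            (Real.exp (-β * wilsonAction (fundamentalRep (Fin 3)) (LatticeRP.splice WilsonRP.crossEdges (U, 1))) : ℂ)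
          ∂(Measure.pi fun _ : Edge 4 L => haarProbability (Matrix.specialUnitaryGroup (Fin 3) ℂ)) := by
  haveI : SecondCountableTopology (Matrix (Fin 3) (Fin 3) ℂ) :=
    inferInstanceAs (SecondCountableTopology (Fin 3 → Fin 3 → ℂ))
  haveI : SecondCountableTopology (Matrix.specialUnitaryGroup (Fin 3) ℂ) :=
    TopologicalSpace.Subtype.secondCountableTopology _
  refine integral_eq_integral_splice_crossEdges h4
    (F := fun U => (∏ f, (bondWilsonDiracAP E U (m f)).det) *
      (Real.exp (-β * wilsonAction (fundamentalRep (Fin 3)) U) : ℂ)) fun g U => ?_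
  simp only [det_bondWilsonDiracAP_gaugeTransform, wilsonAction_gaugeTransform]

end Summit.QuantumFields.QCD.Theorems.UnquenchedChessboardBoundLine

end
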